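import Summits.NavierStokesRegularity.NavierStokesRegularity.Theses.DirectionDissipationQuantum
import Literature.Analysis.FluidPDE.DirectionDissipationBudget

/-!
# `DirectionDissipationNonConcentration` (stmt-NavierStokesRegularity-1922) — birth skeleton `Lines/birth.lean`

Route `DirectionDissipationQuantum`, crux N (rank 4): for every classical Navier–Stokes solution
(`ν = 1`, `f = 0`) on `ℝ³ × [0,T)` which is Leray–Hopf from a rapidly decaying datum, at EVERY
top point `(T, x)` the scaled direction dissipation
`G(r, (T,x); u) = r⁻¹ ∫∫_{Q_r(T,x)} |ω| |∇ξ|²` (`scaledDirectionDissipation`, density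
`d = |ω||∇ξ|² = directionDissipationDensity`, `Q_r` the backward parabolic cylinder) tends to `0`
as `r → 0`.

LINE "parabolic Hardy potential of the direction dissipation".  Write
`ρ_{(T,x)}(t, y) := |y − x| + √(T − t)` for the parabolic distance to the top point and
`P(T, x; u) := ∫∫_{(0,T) × ℝ³} d(t,y) / ρ_{(T,x)}(t,y)` (the PARABOLIC `1/ρ`-POTENTIAL of the
direction dissipation evaluated at the top point; in `ℝ≥0∞`).  On `Q_r(T,x)` one has `ρ < 2r`,
so `G(r) ≤ 2 ∫∫_{Q_r} d/ρ`, and `P < ∞` forces `G(r) → 0` by absolute continuity of the integral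
on the shrinking cylinders (`stub_parabolicHardyDomination`, pure measure theory, M).  Finiteness
of `P` is split by the regular/singular dichotomy at `(T,x)`:

* `stub_vorticityC2Bound_of_boundedNearTop` (KNOWN, Serrin-type local higher regularity up to the
  top time, L): if `u` is bounded on a backward cylinder `Q_r(T,x)` then `∇ω` and `D²ω` are bounded
  on a smaller one;
* `stub_finitePotential_of_vorticityC2Bound` (PROVABLE, L; the REGULAR-POINT CASE of N, cf. the
  refuter evidence EVIDENCE_1922_regular_time.md): `C²`-bounded vorticity near `(T,x)` gives
  `P(T,x;u) < ∞`.  Mechanism (no analyticity, no structure of the zero set of `ω` needed): with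
  Constantin's regularised modulus `|ω|_ε = √(|ω|² + ε²)` one has on all of `ℝ³`
  `Δ|ω|_ε = (ω·Δω)/|ω|_ε + d_ε`, `d_ε ≥ |ω|⁴|∇ξ|²/|ω|_ε³ ↑ d` (the device of the tree's PROVED
  `constantin1990_direction_dissipation_bound_holds`), hence for a cut-off `φ` at scale `s` around
  any centre, `∫ d φ ≤ liminf_ε ∫ d_ε φ = liminf_ε (−∫ ∇|ω|_ε·∇φ − ∫ (ω·Δω/|ω|_ε) φ)
  ≤ C (s² ‖∇ω‖_∞ + s³ ‖Δω‖_∞)`, i.e. the SLICE ESTIMATE `∫_{B_s} d(t,·) ≤ C s²` uniformly in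
  `t ∈ (T − r², T)`; dyadic shells in space give `∫_{B_r(x)} d(t,y)/|y−x| dy ≤ C r`, so the near
  part of `P` is `≤ C r³`; off `Q_{r}(T,x)` the weight is `≤ 2/r` and the far part is bounded by
  `(2/r) ∫∫_{(0,T)×ℝ³} d ≤ (2/r)(‖ω₀‖₁ + ½‖u₀‖₂²) < ∞` (Constantin's budget, PROVED in tree);
* `stub_finitePotential_at_singularPoint` (OPEN — the content of N, in potential form): at a top
  point near which `u` is unbounded on every backward cylinder, still `P(T,x;u) < ∞`.  This is
  STRONGER than N at that point (`P < ∞` ⇔ `Σ_k G(2^{-k}) < ∞`-type summability versus `G → 0`)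
  and names the mechanism the line proposes: test the `|ω|`-balance
  `(∂ₜ + u·∇ − Δ)|ω| + d = (ξ·Sξ)|ω|` against the parabolic Hardy weight `1/ρ_{(T,x)}` (the
  weight-`1` test IS Constantin's budget); the enemy is the Hardy-weighted stretching
  `∫∫ (ξ·Sξ)₊|ω|/ρ`, which must be depleted since `∫∫ |∇u|²/ρ = ∞` at a CKN-singular point
  (`E(r) ≥ ε` along a sequence of scales).  Why it might fail: exactly why N might — it is
  NoBlowup-hard (vacuous iff no singular points); a kinked concentrating vortex tube would have
  `G ≍ 1`.

Glue `DirectionDissipationNonConcentration_of` concludes the crux BY NAME with no hypotheses and no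
direct `sorry` (it invokes the four named stubs): fix `T, u, p, x, η`; by cases on boundedness of
`u` near `(T,x)` obtain `P(T,x;u) ≠ ⊤` from stubs 2+3 or stub 4; stub 1 turns it into
`G(r) ≤ η` for `r < r₀`; `scaledDirectionDissipation_eq` is the `rfl` bridge to the route's inline
expression.

Disproof used: none — no `Disproof.lean` / Negative lemma exists for this crux (`ledger crux ls
stmt-NavierStokesRegularity-1922`: no workfiles, 2026-08-17); `ledger negatives --problem
NavierStokesRegularity` lists 4 refuted statements (SymmetryModuliCount 4055, PerpetualPump 1832,
AdiabaticEddy 1429, Blowup 0154), none about direction dissipation, parabolic potentials or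
regular-point dichotomies.  Evidence honoured: EVIDENCE_1922_regular_time.md (refuter, 2026-08-15:
N holds at regular top points; content at singular `T` only) — stubs 2–3 are that regular case
made checkable without analyticity, stub 4 is the singular case isolated.
-/

noncomputable section

-- the summit and its single problem share the name `NavierStokesRegularity` (D-0017 nested layout)
set_option linter.dupNamespace false

namespace Summit.NavierStokesRegularity.NavierStokesRegularity.Cruxes.DirectionDissipationNonConcentration.Birth

open Set MeasureTheory Metric
open Literature.Analysis.FluidPDE

/-! ## Stubs -/

/-- STUB 1 (pure measure theory, M).  **Parabolic Hardy domination.**  For ANY field `u`, `T > 0`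
and `x`: if the parabolic `1/ρ`-potential of the direction-dissipation density at the top point,
`P(T,x;u) = ∫∫_{(0,T)×ℝ³} d(t,y) / (|y − x| + √(T − t))`, is finite, then
`G(r,(T,x);u) = r⁻¹∫∫_{Q_r(T,x)} d → 0` as `r → 0⁺` (in the route's `∀ η ∃ r₀` form).
Proof sketch: for `0 < r ≤ √T` the cylinder `Q_r(T,x)` lies in the slab and on it
`|y − x| + √(T − t) < 2r`, so `(ofReal r)⁻¹ · ofReal d ≤ 2 · ofReal d / ofReal ρ` pointwise and
`G(r) ≤ 2 ∫∫_{Q_r} d/ρ` (`lintegral_const_mul'`, no measurability needed); the right side tends to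
`0` by `tendsto_setLIntegral_zero` for the finite measure `(d/ρ) · volume|_{slab}` since
`volume (Q_r) = r² · |B_r| → 0`. -/
theorem stub_parabolicHardyDomination :
    ∀ T : ℝ, 0 < T →
      ∀ (u : ℝ → EuclideanSpace ℝ (Fin 3) → EuclideanSpace ℝ (Fin 3)) (x : EuclideanSpace ℝ (Fin 3)),
        (∫⁻ q in Set.Ioo 0 T ×ˢ (Set.univ : Set (EuclideanSpace ℝ (Fin 3))),
            ENNReal.ofReal (directionDissipationDensity u q.1 q.2) /
              ENNReal.ofReal (dist q.2 x + Real.sqrt (T - q.1))) ≠ ⊤ →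
        ∀ η : ℝ, 0 < η → ∃ r₀ : ℝ, 0 < r₀ ∧ ∀ r ∈ Set.Ioo 0 r₀,
          scaledDirectionDissipation r (T, x) u ≤ ENNReal.ofReal η := by
  sorry

/-- STUB 2 (KNOWN mathematics — Serrin-type local higher regularity up to the top time; L in Lean).
**Bounded velocity near a top point gives `C²`-bounded vorticity near it.**  For a classical
Navier–Stokes solution (`ν = 1`, `f = 0`) on `ℝ³ × [0,T)`, Leray–Hopf from a rapidly decaying datum:
if `‖u‖ ≤ M` on a backward cylinder `Q_r(T,x)`, then `‖∇ω‖` and `‖D²ω‖` (`ω = curl u`) are bounded on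
some smaller backward cylinder `Q_{r'}(T,x)` (Serrin 1962 interior regularity via the vorticity
equation `∂ₜω − Δω = curl (u × ω)`: parabolic interior estimates need room only below and beside the
cylinder, not at its top; slice-wise elliptic control of `∇ᵏu` from `curl u`, `div u = 0` and
`u ∈ L^∞`).  The prover may take in-tree local-regularity facts as hypotheses-by-name if the grounder
so rules. -/
theorem stub_vorticityC2Bound_of_boundedNearTop :
    ∀ T : ℝ, 0 < T →
      ∀ (u : ℝ → EuclideanSpace ℝ (Fin 3) → EuclideanSpace ℝ (Fin 3))
        (p : ℝ → EuclideanSpace ℝ (Fin 3) → ℝ),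
        IsClassicalNSSolutionOn (Set.Ico 0 T) 1 0 u p → IsLerayHopfOn T 1 0 (u 0) u →
          HasRapidSpatialDecay (u 0) →
          ∀ x : EuclideanSpace ℝ (Fin 3),
            (∃ r : ℝ, 0 < r ∧ ∃ M : ℝ, ∀ t ∈ Set.Ioo (T - r ^ 2) T, ∀ y ∈ Metric.ball x r,
                ‖u t y‖ ≤ M) →
            ∃ r : ℝ, 0 < r ∧ ∃ M : ℝ, ∀ t ∈ Set.Ioo (T - r ^ 2) T, ∀ y ∈ Metric.ball x r,
              ‖fderiv ℝ (curl (u t)) y‖ ≤ M ∧ ‖iteratedFDeriv ℝ 2 (curl (u t)) y‖ ≤ M := by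
  sorry

/-- STUB 3 (PROVABLE, L — the regular-point case of N in potential form).  **`C²`-bounded vorticity
near the top point gives a finite parabolic potential.**  Same class; if `‖∇ω‖, ‖D²ω‖ ≤ M` on a
backward cylinder `Q_r(T,x)`, then `P(T,x;u) = ∫∫_{(0,T)×ℝ³} d/(|y−x| + √(T−t)) < ∞`.
Mechanism: (i) SLICE ESTIMATE without analyticity — with `|ω|_ε = √(|ω|²+ε²)`,
`Δ|ω|_ε = (ω·Δω)/|ω|_ε + d_ε` on `ℝ³` and `d_ε ≥ |ω|⁴|∇ξ|²/|ω|_ε³ ↑ d = |ω||∇ξ|²` as `ε ↓ 0`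
(the regularisation of the tree's proof of `constantin1990_direction_dissipation_bound_holds`), so for
a cut-off `φ` (`= 1` on `B_s`, supported in `B_{2s}`, `|∇φ| ≤ C/s`) monotone convergence and two
integrations by parts give `∫_{B_s} d(t,·) ≤ C (s²‖∇ω(t)‖_∞ + s³‖Δω(t)‖_∞)` on `B_{2s} ⊆ B_r(x)`;
(ii) dyadic shells in space: `∫_{B_{r/2}(x)} d(t,y)/|y − x| dy ≤ C' r` uniformly in
`t ∈ (T − r²/4, T)`, hence `∫∫_{Q_{r/2}(T,x)} d/ρ ≤ C' r³`; (iii) off `Q_{r/2}(T,x)` and inside the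
slab the weight is `≤ 4/r`, and `∫∫_{(0,T)×ℝ³} d ≤ ‖ω₀‖_{L¹} + ½‖u₀‖²_{L²} < ∞` by Constantin's budget
(PROVED: `constantin1990_direction_dissipation_bound_holds`, `….unit_viscosity`;
`integrable_norm_curl_of_hasRapidSpatialDecay`). -/
theorem stub_finitePotential_of_vorticityC2Bound :
    ∀ T : ℝ, 0 < T →
      ∀ (u : ℝ → EuclideanSpace ℝ (Fin 3) → EuclideanSpace ℝ (Fin 3))
        (p : ℝ → EuclideanSpace ℝ (Fin 3) → ℝ),
        IsClassicalNSSolutionOn (Set.Ico 0 T) 1 0 u p → IsLerayHopfOn T 1 0 (u 0) u →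
          HasRapidSpatialDecay (u 0) →
          ∀ x : EuclideanSpace ℝ (Fin 3),
            (∃ r : ℝ, 0 < r ∧ ∃ M : ℝ, ∀ t ∈ Set.Ioo (T - r ^ 2) T, ∀ y ∈ Metric.ball x r,
                ‖fderiv ℝ (curl (u t)) y‖ ≤ M ∧ ‖iteratedFDeriv ℝ 2 (curl (u t)) y‖ ≤ M) →
            (∫⁻ q in Set.Ioo 0 T ×ˢ (Set.univ : Set (EuclideanSpace ℝ (Fin 3))),
                ENNReal.ofReal (directionDissipationDensity u q.1 q.2) /
                  ENNReal.ofReal (dist q.2 x + Real.sqrt (T - q.1))) ≠ ⊤ := by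
  sorry

/-- STUB 4 (OPEN — the content of the crux, hardest).  **Finite parabolic potential of the direction
dissipation at a singular top point.**  Same class; if `u` is UNBOUNDED on every backward cylinder
`Q_r(T,x)` (a singular point in the sense of the route's items A/B and `BoundedNearTopExtends`), then
still `P(T,x;u) = ∫∫_{(0,T)×ℝ³} |ω||∇ξ|² / (|y − x| + √(T − t)) < ∞`.  Strictly stronger than N at
`(T,x)` (summability of `G` over dyadic scales rather than `G → 0`); proposed mechanism: the
`|ω|`-balance `(∂ₜ + u·∇ − Δ)|ω| + d = (ξ·Sξ)|ω|` tested against the parabolic Hardy weight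
`1/ρ_{(T,x)}` (weight `1` gives Constantin's budget), the Hardy-weighted stretching `∫∫(ξ·Sξ)₊|ω|/ρ`
being the term to deplete (`∫∫|∇u|²/ρ = ∞` at a CKN-singular point, so no energy-class bound can do
it: `Literature.Barriers.NavierStokesRegularity.EnergySupercriticality` bites here exactly as on N).
NoBlowup-hard; vacuously true iff `(T,x)` is never singular. -/
theorem stub_finitePotential_at_singularPoint :
    ∀ T : ℝ, 0 < T →
      ∀ (u : ℝ → EuclideanSpace ℝ (Fin 3) → EuclideanSpace ℝ (Fin 3))
        (p : ℝ → EuclideanSpace ℝ (Fin 3) → ℝ),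
        IsClassicalNSSolutionOn (Set.Ico 0 T) 1 0 u p → IsLerayHopfOn T 1 0 (u 0) u →
          HasRapidSpatialDecay (u 0) →
          ∀ x : EuclideanSpace ℝ (Fin 3),
            (¬ ∃ r : ℝ, 0 < r ∧ ∃ M : ℝ, ∀ t ∈ Set.Ioo (T - r ^ 2) T, ∀ y ∈ Metric.ball x r,
                ‖u t y‖ ≤ M) →
            (∫⁻ q in Set.Ioo 0 T ×ˢ (Set.univ : Set (EuclideanSpace ℝ (Fin 3))),
                ENNReal.ofReal (directionDissipationDensity u q.1 q.2) /
                  ENNReal.ofReal (dist q.2 x + Real.sqrt (T - q.1))) ≠ ⊤ := by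
  sorry

/-! ## Glue -/

/-- **The four stubs imply the crux `DirectionDissipationNonConcentration` (concluded BY NAME; no
hypotheses; the only `sorry`s of the file sit inside the four `stub_*` declarations it invokes).**
Logical shape: `stub 2 → stub 3 → stub 4 → stub 1 → N`.  Fix `T, u, p, x, η`; by cases on
boundedness of `u` on some backward cylinder at `(T,x)`, the parabolic potential `P(T,x;u)` is
finite by stubs 2+3 (regular point) or by stub 4 (singular point); stub 1 converts finiteness into
`G(r,(T,x);u) ≤ η` for `0 < r < r₀`; `scaledDirectionDissipation_eq` (`rfl`) bridges to the route's
inline expression. -/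
theorem DirectionDissipationNonConcentration_of :
    _root_.Summit.NavierStokesRegularity.NavierStokesRegularity.Theses.DirectionDissipationQuantum.DirectionDissipationNonConcentration := by
  intro T hT u p hcl hLH hdec x η hη
  have hfin : (∫⁻ q in Set.Ioo 0 T ×ˢ (Set.univ : Set (EuclideanSpace ℝ (Fin 3))),
      ENNReal.ofReal (directionDissipationDensity u q.1 q.2) /
        ENNReal.ofReal (dist q.2 x + Real.sqrt (T - q.1))) ≠ ⊤ := by
    by_cases hreg : ∃ r : ℝ, 0 < r ∧ ∃ M : ℝ, ∀ t ∈ Set.Ioo (T - r ^ 2) T,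
        ∀ y ∈ Metric.ball x r, ‖u t y‖ ≤ M
    · exact stub_finitePotential_of_vorticityC2Bound T hT u p hcl hLH hdec x
        (stub_vorticityC2Bound_of_boundedNearTop T hT u p hcl hLH hdec x hreg)
    · exact stub_finitePotential_at_singularPoint T hT u p hcl hLH hdec x hreg
  obtain ⟨r₀, hr₀, hG⟩ := stub_parabolicHardyDomination T hT u x hfin η hη
  refine ⟨r₀, hr₀, fun r hr => ?_⟩
  rw [← scaledDirectionDissipation_eq]
  exact hG r hr

end Summit.NavierStokesRegularity.NavierStokesRegularity.Cruxes.DirectionDissipationNonConcentration.Birth
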